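import Summits.CriticalPhenomena.Ising3DConformalLimit.Theorems.IsingEuclidUpgradeR2RotInvPowerLaw.Negative.GaugeBookkeeping
import HarnessLib

/-!
# Crux `IsingEuclidUpgradeR2RotInvPowerLaw` (stmt-CriticalPhenomena-0634) — negative-side support, IV: a reflection-positive log₂-periodic axis gauge (W4)

Standing crux disprover (cdisprove cycle 1, 2026-08-17), THEOREM-ONLY file (no definitions); the toolkit behind
finding F2′ (`Negative/LaplaceGaugeSeparation.lean`): the AXIS toolkit of the tree — positivity, monotonicity,
log-convexity, half-line reflection positivity, the envelope — together with the dyadic tower law T1 does not imply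
the integer dilation law S2.

**The gauge** (through defining hypotheses `hw`, `hh`; `τ := 2π / log 2`, `‖ζ‖ = 1` a phase):
`w t = 1 + ½ Re (ζ t^{iτ})` — a positive (`½ ≤ w ≤ 3/2`), log₂-PERIODIC (`w (2t) = w t`, since `2^{iτ} = 1`)
density — and its Laplace transform `h r = ∫₀^∞ e^{-rt} w(t) dt`. Proved here:
* `h_bounds`: `1/(2r) ≤ h r ≤ 3/(2r)`; `h_antitone`; `h_posDef`: `Σ c_a c_b h(s_a + s_b) ≥ 0` for `s_a > 0`
  (Bernstein: `h` is a Laplace transform of a positive measure, i.e. completely monotone / reflection positive on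
  the half-line semigroup);
* `h_two_mul`, `h_two_pow_mul`: EXACT discrete scale invariance `h (2r) = h r / 2` (change of variables + the
  log₂-periodicity of `w`) — so along the towers `2^j` and `3·2^j` the sequence is `h 1 / 2^j`, `h 3 / 2^j`;
* `h_eq_gamma`: the closed form `h r = 1/r + ½ Re (ζ (1/r)^{1+iτ} Γ(1+iτ))` (Euler's integral, Mathlib's
  `Complex.integral_cpow_mul_exp_neg_mul_Ioi`), whence `h 1` and `3 h 3` (`h_one`, `three_mul_h_three`);
* `h_one_sub_three_mul_h_three`: for the phase `ζ = z̄/‖z‖`, `z = Γ(1+iτ)(1 − (1/3)^{iτ}) ≠ 0`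
  (`gamma_ne_zero'`, `third_cpow_tau_I_ne_one` — because `log₂ 3 ∉ ℤ`), one has `h 1 − 3 h 3 = ‖z‖/2 > 0`:
  the `k = 3` dilation ratio along the dyadic tower is the constant `3h(3)/h(1) ≠ 1`.
-/

noncomputable section

namespace Summit.CriticalPhenomena.Ising3DConformalLimit.Theorems.IsingEuclidUpgradeR2RotInvPowerLaw.Negative

open Filter Topology MeasureTheory Set
open scoped ComplexConjugate

/-! ## The modulation `w t = 1 + ½ Re (ζ t^{iτ})`, `τ = 2π / log 2`, `‖ζ‖ = 1` -/

/-- `τ = 2π / log 2 > 0`. -/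
theorem tau_pos : 0 < 2 * Real.pi / Real.log 2 := div_pos (by positivity) (Real.log_pos one_lt_two)

/-- `‖t^{iτ}‖ = 1` for `t > 0`. -/
theorem norm_cpow_tau_I {t : ℝ} (ht : 0 < t) (τ : ℝ) : ‖(t : ℂ) ^ ((τ : ℂ) * Complex.I)‖ = 1 := by
  rw [Complex.norm_cpow_eq_rpow_re_of_pos ht]
  simp

/-- The modulation is squeezed: `1/2 ≤ w t ≤ 3/2` for `t > 0`. -/
theorem w_bounds {w : ℝ → ℝ} {ζ : ℂ} (hζ : ‖ζ‖ = 1)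
    (hw : ∀ t, w t = 1 + (1 / 2) * (ζ * (t : ℂ) ^ (((2 * Real.pi / Real.log 2 : ℝ) : ℂ) * Complex.I)).re)
    {t : ℝ} (ht : 0 < t) : 1 / 2 ≤ w t ∧ w t ≤ 3 / 2 := by
  have hn : ‖ζ * (t : ℂ) ^ (((2 * Real.pi / Real.log 2 : ℝ) : ℂ) * Complex.I)‖ = 1 := by
    rw [norm_mul, hζ, norm_cpow_tau_I ht, one_mul]
  have hre := Complex.abs_re_le_norm (ζ * (t : ℂ) ^ (((2 * Real.pi / Real.log 2 : ℝ) : ℂ) * Complex.I))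
  rw [hn] at hre
  rw [hw]
  constructor <;> nlinarith [abs_le.1 hre]

/-- `2^{iτ} = 1` for `τ = 2π / log 2`. -/
theorem two_cpow_tau_I : ((2 : ℝ) : ℂ) ^ (((2 * Real.pi / Real.log 2 : ℝ) : ℂ) * Complex.I) = 1 := by
  rw [Complex.cpow_def_of_ne_zero (by norm_num), Complex.exp_eq_one_iff]
  refine ⟨1, ?_⟩
  have hlog : Complex.log ((2 : ℝ) : ℂ) = ((Real.log 2 : ℝ) : ℂ) := (Complex.ofReal_log (by norm_num)).symm
  rw [hlog]
  have hL : ((Real.log 2 : ℝ) : ℂ) ≠ 0 := by exact_mod_cast (Real.log_pos one_lt_two).ne'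
  push_cast
  field_simp

/-- The modulation is log₂-periodic: `w (2t) = w t` for `t > 0`. -/
theorem w_two_mul {w : ℝ → ℝ} {ζ : ℂ}
    (hw : ∀ t, w t = 1 + (1 / 2) * (ζ * (t : ℂ) ^ (((2 * Real.pi / Real.log 2 : ℝ) : ℂ) * Complex.I)).re)
    {t : ℝ} (ht : 0 < t) : w (2 * t) = w t := by
  rw [hw, hw, Complex.ofReal_mul, Complex.mul_cpow_ofReal_nonneg (by norm_num) ht.le, two_cpow_tau_I, one_mul]

/-- The modulation is continuous on `(0, ∞)`. -/
theorem w_continuousOn {w : ℝ → ℝ} {ζ : ℂ}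
    (hw : ∀ t, w t = 1 + (1 / 2) * (ζ * (t : ℂ) ^ (((2 * Real.pi / Real.log 2 : ℝ) : ℂ) * Complex.I)).re) :
    ContinuousOn w (Ioi 0) := by
  have : w = fun t : ℝ => 1 + (1 / 2) * (ζ * (t : ℂ) ^ (((2 * Real.pi / Real.log 2 : ℝ) : ℂ) * Complex.I)).re :=
    funext hw
  rw [this]
  refine continuousOn_const.add (continuousOn_const.mul ?_)
  refine Complex.continuous_re.comp_continuousOn (continuousOn_const.mul ?_)
  intro t ht
  refine ContinuousAt.continuousWithinAt ?_
  exact (continuousAt_cpow_const (Complex.ofReal_mem_slitPlane.2 ht)).comp Complex.continuous_ofReal.continuousAt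

/-! ## The Laplace transform `h r = ∫₀^∞ e^{-rt} w(t) dt` -/

/-- Integrability of `e^{-rt} w(t)` on `(0, ∞)`. -/
theorem integrableOn_exp_mul_w {w : ℝ → ℝ} {ζ : ℂ} (hζ : ‖ζ‖ = 1)
    (hw : ∀ t, w t = 1 + (1 / 2) * (ζ * (t : ℂ) ^ (((2 * Real.pi / Real.log 2 : ℝ) : ℂ) * Complex.I)).re)
    {r : ℝ} (hr : 0 < r) : IntegrableOn (fun t => Real.exp (-(r * t)) * w t) (Ioi 0) := by
  have hg : IntegrableOn (fun t : ℝ => 3 / 2 * Real.exp (-(r * t))) (Ioi 0) := by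
    have h0 : IntegrableOn (fun t : ℝ => 3 / 2 * Real.exp (-r * t)) (Ioi 0) :=
      (exp_neg_integrableOn_Ioi 0 hr).const_mul (3 / 2)
    refine h0.congr_fun (fun t _ => ?_) measurableSet_Ioi
    simp only [neg_mul]
  refine Integrable.mono' hg ?_ ?_
  · refine ContinuousOn.aestronglyMeasurable ?_ measurableSet_Ioi
    exact ((Real.continuous_exp.comp (continuous_const.mul continuous_id).neg).continuousOn).mul
      (w_continuousOn hw)
  · refine (ae_restrict_iff' measurableSet_Ioi).2 (ae_of_all _ fun t ht => ?_)
    have hb := w_bounds hζ hw ht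
    rw [Real.norm_eq_abs, abs_mul, abs_of_pos (Real.exp_pos _), abs_of_pos (by linarith)]
    have := Real.exp_pos (-(r * t))
    nlinarith

/-- The Laplace transform is squeezed: `1/(2r) ≤ h r ≤ 3/(2r)` for `r > 0`. -/
theorem h_bounds {w h : ℝ → ℝ} {ζ : ℂ} (hζ : ‖ζ‖ = 1)
    (hw : ∀ t, w t = 1 + (1 / 2) * (ζ * (t : ℂ) ^ (((2 * Real.pi / Real.log 2 : ℝ) : ℂ) * Complex.I)).re)
    (hh : ∀ r, h r = ∫ t in Ioi (0 : ℝ), Real.exp (-(r * t)) * w t)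
    {r : ℝ} (hr : 0 < r) : 1 / (2 * r) ≤ h r ∧ h r ≤ 3 / (2 * r) := by
  have hint := integrableOn_exp_mul_w hζ hw hr
  have hexp : IntegrableOn (fun t : ℝ => Real.exp (-(r * t))) (Ioi 0) := by
    refine (exp_neg_integrableOn_Ioi 0 hr).congr_fun (fun t _ => ?_) measurableSet_Ioi
    simp [neg_mul]
  have hI : ∫ t in Ioi (0 : ℝ), Real.exp (-(r * t)) = 1 / r := by
    have hc := integral_comp_mul_left_Ioi (fun x : ℝ => Real.exp (-x)) 0 hr
    simp only [mul_zero] at hc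
    rw [hc, integral_exp_neg_Ioi_zero]
    simp [one_div]
  rw [hh]
  constructor
  · calc 1 / (2 * r) = ∫ t in Ioi (0 : ℝ), 1 / 2 * Real.exp (-(r * t)) := by
          rw [integral_const_mul, hI]; field_simp
      _ ≤ ∫ t in Ioi (0 : ℝ), Real.exp (-(r * t)) * w t := by
          refine setIntegral_mono_on (hexp.const_mul _) hint measurableSet_Ioi fun t ht => ?_
          have := (w_bounds hζ hw ht).1
          have := Real.exp_pos (-(r * t))
          nlinarith
  · calc (∫ t in Ioi (0 : ℝ), Real.exp (-(r * t)) * w t) ≤ ∫ t in Ioi (0 : ℝ), 3 / 2 * Real.exp (-(r * t)) := by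
          refine setIntegral_mono_on hint (hexp.const_mul _) measurableSet_Ioi fun t ht => ?_
          have := (w_bounds hζ hw ht).2
          have := Real.exp_pos (-(r * t))
          nlinarith
      _ = 3 / (2 * r) := by rw [integral_const_mul, hI]; field_simp

/-- Exact discrete scale invariance: `h (2r) = h r / 2` for `r > 0` (the modulation is log₂-periodic). -/
theorem h_two_mul {w h : ℝ → ℝ} {ζ : ℂ}
    (hw : ∀ t, w t = 1 + (1 / 2) * (ζ * (t : ℂ) ^ (((2 * Real.pi / Real.log 2 : ℝ) : ℂ) * Complex.I)).re)
    (hh : ∀ r, h r = ∫ t in Ioi (0 : ℝ), Real.exp (-(r * t)) * w t) (r : ℝ) :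
    h (2 * r) = h r / 2 := by
  rw [hh, hh]
  have hsub := integral_comp_mul_left_Ioi (fun s : ℝ => Real.exp (-(r * s)) * w s) 0 two_pos
  simp only [mul_zero, smul_eq_mul] at hsub
  rw [← setIntegral_congr_fun measurableSet_Ioi (fun t (ht : t ∈ Ioi (0:ℝ)) => ?foo)] at hsub
  · rw [hsub]; field_simp
  · show Real.exp (-(2 * r * t)) * w t = Real.exp (-(r * (2 * t))) * w (2 * t)
    rw [w_two_mul hw ht]; ring_nf

/-- Iterated: `h (2^j r) = h r / 2^j`. -/
theorem h_two_pow_mul {w h : ℝ → ℝ} {ζ : ℂ}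
    (hw : ∀ t, w t = 1 + (1 / 2) * (ζ * (t : ℂ) ^ (((2 * Real.pi / Real.log 2 : ℝ) : ℂ) * Complex.I)).re)
    (hh : ∀ r, h r = ∫ t in Ioi (0 : ℝ), Real.exp (-(r * t)) * w t) (r : ℝ) (j : ℕ) :
    h (2 ^ j * r) = h r / 2 ^ j := by
  induction j with
  | zero => simp
  | succ j ih =>
    rw [pow_succ, mul_comm ((2:ℝ) ^ j) 2, mul_assoc, h_two_mul hw hh, ih, div_div, mul_comm]

/-- The Laplace transform is antitone on `(0, ∞)`. -/
theorem h_antitone {w h : ℝ → ℝ} {ζ : ℂ} (hζ : ‖ζ‖ = 1)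
    (hw : ∀ t, w t = 1 + (1 / 2) * (ζ * (t : ℂ) ^ (((2 * Real.pi / Real.log 2 : ℝ) : ℂ) * Complex.I)).re)
    (hh : ∀ r, h r = ∫ t in Ioi (0 : ℝ), Real.exp (-(r * t)) * w t)
    {r r' : ℝ} (hr : 0 < r) (hrr' : r ≤ r') : h r' ≤ h r := by
  rw [hh, hh]
  refine setIntegral_mono_on (integrableOn_exp_mul_w hζ hw (lt_of_lt_of_le hr hrr'))
    (integrableOn_exp_mul_w hζ hw hr) measurableSet_Ioi fun t ht => ?_
  have ht' : (0 : ℝ) < t := ht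
  have hwpos : 0 < w t := by linarith [(w_bounds hζ hw ht').1]
  have : Real.exp (-(r' * t)) ≤ Real.exp (-(r * t)) := Real.exp_le_exp.2 (by nlinarith)
  nlinarith

/-- **Half-line reflection positivity** of the Laplace transform: `Σ_{a,b} c_a c_b h(s_a + s_b) ≥ 0` for
positive "times" `s_a` (it is `∫ (Σ_a c_a e^{-s_a t})² w(t) dt` with `w ≥ 0`). -/
theorem h_posDef {w h : ℝ → ℝ} {ζ : ℂ} (hζ : ‖ζ‖ = 1)
    (hw : ∀ t, w t = 1 + (1 / 2) * (ζ * (t : ℂ) ^ (((2 * Real.pi / Real.log 2 : ℝ) : ℂ) * Complex.I)).re)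
    (hh : ∀ r, h r = ∫ t in Ioi (0 : ℝ), Real.exp (-(r * t)) * w t)
    {m : ℕ} (s : Fin m → ℝ) (c : Fin m → ℝ) (hs : ∀ a, 0 < s a) :
    0 ≤ ∑ a, ∑ b, c a * c b * h (s a + s b) := by
  have hint : ∀ a b, IntegrableOn (fun t => c a * c b * (Real.exp (-((s a + s b) * t)) * w t)) (Ioi 0) :=
    fun a b => (integrableOn_exp_mul_w hζ hw (add_pos (hs a) (hs b))).const_mul _
  have e : (∑ a, ∑ b, c a * c b * h (s a + s b)) =
      ∫ t in Ioi (0 : ℝ), ∑ a, ∑ b, c a * c b * (Real.exp (-((s a + s b) * t)) * w t) := by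
    rw [integral_finsetSum _ fun a _ => integrable_finsetSum _ fun b _ => hint a b]
    refine Finset.sum_congr rfl fun a _ => ?_
    rw [integral_finsetSum _ fun b _ => hint a b]
    refine Finset.sum_congr rfl fun b _ => ?_
    rw [integral_const_mul, hh]
  rw [e]
  refine setIntegral_nonneg measurableSet_Ioi fun t ht => ?_
  have hwpos : 0 ≤ w t := by linarith [(w_bounds hζ hw ht).1]
  have key : (∑ a, ∑ b, c a * c b * (Real.exp (-((s a + s b) * t)) * w t)) =
      (∑ a, c a * Real.exp (-(s a * t))) ^ 2 * w t := by
    rw [sq, Finset.sum_mul_sum, Finset.sum_mul]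
    refine Finset.sum_congr rfl fun a _ => ?_
    rw [Finset.sum_mul]
    refine Finset.sum_congr rfl fun b _ => ?_
    rw [add_mul, neg_add, Real.exp_add]
    ring
  rw [key]
  positivity

/-- Integrability of the complex integrand `t^{iτ} e^{-rt}` on `(0, ∞)`. -/
theorem integrableOn_cpow_mul_exp {r : ℝ} (hr : 0 < r) :
    IntegrableOn (fun t : ℝ => (t : ℂ) ^ (((2 * Real.pi / Real.log 2 : ℝ) : ℂ) * Complex.I) *
      Complex.exp (-((r : ℂ) * (t : ℂ)))) (Ioi 0) := by
  have hg : IntegrableOn (fun t : ℝ => Real.exp (-(r * t))) (Ioi 0) := by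
    refine (exp_neg_integrableOn_Ioi 0 hr).congr_fun (fun t _ => ?_) measurableSet_Ioi
    simp only [neg_mul]
  refine Integrable.mono' hg ?_ ?_
  · refine ContinuousOn.aestronglyMeasurable ?_ measurableSet_Ioi
    refine ContinuousOn.mul ?_ (Continuous.continuousOn ?_)
    · intro t ht
      refine ContinuousAt.continuousWithinAt ?_
      exact (continuousAt_cpow_const (Complex.ofReal_mem_slitPlane.2 ht)).comp
        Complex.continuous_ofReal.continuousAt
    · exact Complex.continuous_exp.comp ((continuous_const.mul Complex.continuous_ofReal).neg)
  · refine (ae_restrict_iff' measurableSet_Ioi).2 (ae_of_all _ fun t (ht : 0 < t) => ?_)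
    rw [norm_mul, norm_cpow_tau_I ht, one_mul]
    have : Complex.exp (-((r : ℂ) * (t : ℂ))) = ((Real.exp (-(r * t)) : ℝ) : ℂ) := by push_cast; rfl
    rw [this, Complex.norm_real, Real.norm_eq_abs, abs_of_pos (Real.exp_pos _)]

/-- **The Laplace transform in closed form**: `h r = 1/r + ½ Re (ζ (1/r)^{1+iτ} Γ(1+iτ))` for `r > 0`
(Euler's integral `∫₀^∞ t^{a-1} e^{-rt} dt = Γ(a)/rᵃ` at `a = 1 + iτ`). -/
theorem h_eq_gamma {w h : ℝ → ℝ} {ζ : ℂ}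
    (hw : ∀ t, w t = 1 + (1 / 2) * (ζ * (t : ℂ) ^ (((2 * Real.pi / Real.log 2 : ℝ) : ℂ) * Complex.I)).re)
    (hh : ∀ r, h r = ∫ t in Ioi (0 : ℝ), Real.exp (-(r * t)) * w t)
    {r : ℝ} (hr : 0 < r) :
    h r = 1 / r + (1 / 2) * (ζ * ((1 / (r : ℂ)) ^ (1 + ((2 * Real.pi / Real.log 2 : ℝ) : ℂ) * Complex.I) *
      Complex.Gamma (1 + ((2 * Real.pi / Real.log 2 : ℝ) : ℂ) * Complex.I))).re := by
  set τ : ℝ := 2 * Real.pi / Real.log 2 with hτ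
  have hexp : IntegrableOn (fun t : ℝ => Real.exp (-(r * t))) (Ioi 0) := by
    refine (exp_neg_integrableOn_Ioi 0 hr).congr_fun (fun t _ => ?_) measurableSet_Ioi
    simp only [neg_mul]
  have hF := integrableOn_cpow_mul_exp hr
  -- split the integrand
  have e1 : ∀ t : ℝ, Real.exp (-(r * t)) * w t = Real.exp (-(r * t)) +
      (1 / 2) * (ζ * ((t : ℂ) ^ ((τ : ℂ) * Complex.I) * Complex.exp (-((r : ℂ) * (t : ℂ))))).re := by
    intro t
    rw [hw]
    have : Complex.exp (-((r : ℂ) * (t : ℂ))) = ((Real.exp (-(r * t)) : ℝ) : ℂ) := by push_cast; rfl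
    rw [this, ← mul_assoc, Complex.re_mul_ofReal]
    ring
  have hI : ∫ t in Ioi (0 : ℝ), Real.exp (-(r * t)) = 1 / r := by
    have hc := integral_comp_mul_left_Ioi (fun x : ℝ => Real.exp (-x)) 0 hr
    simp only [mul_zero] at hc
    rw [hc, integral_exp_neg_Ioi_zero]
    simp [one_div]
  rw [hh]
  simp_rw [e1]
  rw [integral_add hexp ((Integrable.const_mul ((hF.const_mul ζ).re) (1 / 2)).congr ?_),
    hI, integral_const_mul]
  · congr 2
    have hre := integral_re (hF.const_mul ζ)
    simp only [RCLike.re_to_complex] at hre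
    rw [hre, integral_const_mul]
    congr 2
    have hG := Complex.integral_cpow_mul_exp_neg_mul_Ioi (a := 1 + (τ : ℂ) * Complex.I) (r := r)
      (by simp) hr
    rw [← hG]
    refine setIntegral_congr_fun measurableSet_Ioi fun t _ => ?_
    rw [add_sub_cancel_left]
  · exact ae_of_all _ fun t => rfl

/-! ## The two towers `2^j` and `3·2^j`: the values `h 1` and `3 h 3` differ -/

/-- `Γ(1 + iτ) ≠ 0`. -/
theorem gamma_ne_zero' : Complex.Gamma (1 + ((2 * Real.pi / Real.log 2 : ℝ) : ℂ) * Complex.I) ≠ 0 := by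
  apply Complex.Gamma_ne_zero
  intro m hm
  have := congrArg Complex.im hm
  simp only [Complex.add_im, Complex.one_im, Complex.mul_im, Complex.ofReal_re, Complex.ofReal_im,
    Complex.I_re, Complex.I_im, Complex.neg_im, Complex.natCast_im] at this
  norm_num at this

/-- `(1/3)^{iτ} ≠ 1` for `τ = 2π / log 2` (because `log₂ 3 ∉ ℤ`). -/
theorem third_cpow_tau_I_ne_one :
    ((1 / 3 : ℝ) : ℂ) ^ (((2 * Real.pi / Real.log 2 : ℝ) : ℂ) * Complex.I) ≠ 1 := by
  rw [Complex.cpow_def_of_ne_zero (by norm_num), Ne, Complex.exp_eq_one_iff]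
  rintro ⟨n, hn⟩
  have hlog : Complex.log ((1 / 3 : ℝ) : ℂ) = ((Real.log (1 / 3) : ℝ) : ℂ) := (Complex.ofReal_log (by norm_num)).symm
  rw [hlog] at hn
  have him := congrArg Complex.im hn
  simp only [Complex.mul_im, Complex.ofReal_re, Complex.ofReal_im, Complex.I_re, Complex.I_im,
    Complex.mul_re, Complex.intCast_re, Complex.intCast_im, Complex.re_ofNat, Complex.im_ofNat] at him
  simp only [mul_one, mul_zero, add_zero, sub_zero, zero_mul] at him
  -- him : Real.log (1/3) * τ = n * 2π
  have hL : 0 < Real.log 2 := Real.log_pos one_lt_two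
  have h3 : Real.log (1 / 3) = -Real.log 3 := by rw [one_div, Real.log_inv]
  rw [h3] at him
  have h4 : (-Real.log 3 / Real.log 2) * (2 * Real.pi) = (n : ℝ) * (2 * Real.pi) := by rw [← him]; ring
  have h5 := mul_right_cancel₀ (by positivity : (2 * Real.pi) ≠ 0) h4
  have key : Real.logb 2 3 = -n := by
    have : -(Real.log 3 / Real.log 2) = n := by rw [← neg_div]; exact h5
    rw [Real.logb]
    linarith
  have h1 : (1 : ℝ) < Real.logb 2 3 := by
    rw [Real.lt_logb_iff_rpow_lt one_lt_two (by norm_num)]; norm_num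
  have h2 : Real.logb 2 3 < (2 : ℝ) := by
    rw [Real.logb_lt_iff_lt_rpow one_lt_two (by norm_num)]; norm_num
  rw [key] at h1 h2
  have h1' : (1 : ℤ) < -n := by exact_mod_cast h1
  have h2' : -n < (2 : ℤ) := by exact_mod_cast h2
  omega

/-- `h 1 = 1 + ½ Re (ζ Γ(1+iτ))`. -/
theorem h_one {w h : ℝ → ℝ} {ζ : ℂ}
    (hw : ∀ t, w t = 1 + (1 / 2) * (ζ * (t : ℂ) ^ (((2 * Real.pi / Real.log 2 : ℝ) : ℂ) * Complex.I)).re)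
    (hh : ∀ r, h r = ∫ t in Ioi (0 : ℝ), Real.exp (-(r * t)) * w t) :
    h 1 = 1 + (1 / 2) * (ζ * Complex.Gamma (1 + ((2 * Real.pi / Real.log 2 : ℝ) : ℂ) * Complex.I)).re := by
  have := h_eq_gamma hw hh one_pos
  simpa using this

/-- `3 h 3 = 1 + ½ Re (ζ (1/3)^{iτ} Γ(1+iτ))`. -/
theorem three_mul_h_three {w h : ℝ → ℝ} {ζ : ℂ}
    (hw : ∀ t, w t = 1 + (1 / 2) * (ζ * (t : ℂ) ^ (((2 * Real.pi / Real.log 2 : ℝ) : ℂ) * Complex.I)).re)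
    (hh : ∀ r, h r = ∫ t in Ioi (0 : ℝ), Real.exp (-(r * t)) * w t) :
    3 * h 3 = 1 + (1 / 2) * (ζ * (((1 / 3 : ℝ) : ℂ) ^ (((2 * Real.pi / Real.log 2 : ℝ) : ℂ) * Complex.I) *
      Complex.Gamma (1 + ((2 * Real.pi / Real.log 2 : ℝ) : ℂ) * Complex.I))).re := by
  set a : ℂ := ((2 * Real.pi / Real.log 2 : ℝ) : ℂ) * Complex.I with ha
  rw [h_eq_gamma hw hh (by norm_num : (0 : ℝ) < 3)]
  have hsplit : (1 / ((3 : ℝ) : ℂ)) ^ (1 + a) = (((1 / 3 : ℝ) : ℂ)) * (((1 / 3 : ℝ) : ℂ) ^ a) := by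
    rw [Complex.cpow_add _ _ (by norm_num), Complex.cpow_one]
    push_cast
    ring
  rw [hsplit, show ζ * ((((1 / 3 : ℝ) : ℂ)) * (((1 / 3 : ℝ) : ℂ) ^ a) * Complex.Gamma (1 + a)) =
    (((1 / 3 : ℝ) : ℂ)) * (ζ * (((1 / 3 : ℝ) : ℂ) ^ a * Complex.Gamma (1 + a))) by ring, Complex.re_ofReal_mul]
  push_cast
  ring

/-- **The two towers differ.** With `z = Γ(1+iτ)(1 − (1/3)^{iτ}) ≠ 0` and the phase `ζ = z̄/‖z‖`,
`h 1 − 3 h 3 = ‖z‖/2 > 0`. -/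
theorem h_one_sub_three_mul_h_three {w h : ℝ → ℝ} {ζ : ℂ}
    (hζ' : ζ = (starRingEnd ℂ) (Complex.Gamma (1 + ((2 * Real.pi / Real.log 2 : ℝ) : ℂ) * Complex.I) *
      (1 - ((1 / 3 : ℝ) : ℂ) ^ (((2 * Real.pi / Real.log 2 : ℝ) : ℂ) * Complex.I))) /
      ((‖Complex.Gamma (1 + ((2 * Real.pi / Real.log 2 : ℝ) : ℂ) * Complex.I) *
      (1 - ((1 / 3 : ℝ) : ℂ) ^ (((2 * Real.pi / Real.log 2 : ℝ) : ℂ) * Complex.I))‖ : ℝ) : ℂ))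
    (hw : ∀ t, w t = 1 + (1 / 2) * (ζ * (t : ℂ) ^ (((2 * Real.pi / Real.log 2 : ℝ) : ℂ) * Complex.I)).re)
    (hh : ∀ r, h r = ∫ t in Ioi (0 : ℝ), Real.exp (-(r * t)) * w t) :
    0 < h 1 - 3 * h 3 := by
  set a : ℂ := ((2 * Real.pi / Real.log 2 : ℝ) : ℂ) * Complex.I with ha
  set z : ℂ := Complex.Gamma (1 + a) * (1 - ((1 / 3 : ℝ) : ℂ) ^ a) with hz
  have hz0 : z ≠ 0 := mul_ne_zero gamma_ne_zero' (sub_ne_zero.2 (Ne.symm third_cpow_tau_I_ne_one))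
  have hnz : 0 < ‖z‖ := norm_pos_iff.2 hz0
  rw [h_one hw hh, three_mul_h_three hw hh]
  have e : (ζ * Complex.Gamma (1 + a)).re - (ζ * ((((1 / 3 : ℝ) : ℂ)) ^ a * Complex.Gamma (1 + a))).re =
      (ζ * z).re := by
    rw [← Complex.sub_re]
    congr 1
    rw [hz]
    ring
  have hζz : ζ * z = ((‖z‖ : ℝ) : ℂ) := by
    rw [hζ', div_mul_eq_mul_div, Complex.conj_mul', sq]
    field_simp [hnz.ne']
  have : (ζ * z).re = ‖z‖ := by rw [hζz, Complex.ofReal_re]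
  nlinarith [e, this]

/-- The phase `ζ = z̄/‖z‖` is unimodular. -/
theorem norm_phase {z : ℂ} (hz : z ≠ 0) : ‖(starRingEnd ℂ) z / ((‖z‖ : ℝ) : ℂ)‖ = 1 := by
  rw [norm_div, Complex.norm_conj, Complex.norm_real, Real.norm_eq_abs, abs_of_pos (norm_pos_iff.2 hz),
    div_self (norm_ne_zero_iff.2 hz)]

end Summit.CriticalPhenomena.Ising3DConformalLimit.Theorems.IsingEuclidUpgradeR2RotInvPowerLaw.Negative

end
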